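import Summits.QuantumFields.YangMills.Theorems.BalabanUVNodesK2NamedJetsRunRemAt
import Summits.QuantumFields.YangMills.Theorems.BalabanUVNodesSpineRates
import Literature.MathematicalPhysics.QuantumFieldTheory.Balaban1983to89.T4CouplingMatching
import Literature.MathematicalPhysics.QuantumFieldTheory.Balaban1983to89.T4FlagMemory

/-!
# NODE N17 (NE4) — ITS SUPPLIER ROAD TO CRUX K2⁷'s REGISTERED RUN-EDITION STUB 2ᴮ″ `RunRemAtSomeJets` (skeleton v6 5a75a2378c79b303): «full-β scale shift (N17) +
# DEF-1's per-scale ANCHOR at the named numbers + run-wise (C) ⟹ `RunRemAt F κ θ hP θ.cβ`», SPLIT-FREE (no `OneLoopSplit`, no `beta0OfMerged … θ.v₀` number), and the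
# composition {1ᴬ, N17, anchor ∧ survivor continuity} → `EndpointGivenBR13SepCoPH` BY NAME

Cell `pub-ymgap`, YM-PLAN Track A (HUMAN RULINGS D-0062 ∕ D-0149), WIDTH SEAT `pub-ymgap-dag-n17-w1` (generation 3).  Key K3⁷ stmt-QuantumFields-20544 (`--kind proof --supports
20544 --as helper`, COUNT-NEUTRAL); via node N17 also K2⁷ stmt-QuantumFields-20543, whose skeleton OF RECORD v6 (`HOME/pub-ymgap-plan/D82-K2V6/K2Skeleton13SepCoPHv6.lean`, plan g82
DECISION-24ad-BNF) registers exactly 1ᴬ `stub_d1AnchoredJets13 : D1AtAnchoredJets` (L) and 2ᴮ″ `stub_runRemNamedJets13 : RunRemAtSomeJets` (XL, «NODE O's wall») over ym-nodeO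
DEF-1's RUN EDITION `RunRemAt` (`Theorems/BalabanUVNodesK2NamedJetsRunRemAt`, p596574).  THEOREMS ONLY (0 `def`, 0 `instance`, 0 `sorry`); DEF-1's `RunRemAt` ∕
`RunConstRemainder` ∕ `ConstRemainder` ∕ `ScaleAnchor` ∕ `SurvCont` ∕ `beta0OfJs` ∕ `endpointExistence_of_runRemAt_drift` and the tree's `YMDAG.UVSplit.N17At` are
CONSUMED BY NAME; nothing is restated.

THE POINT.  DECISION-24ad-BNF de-registered K2⁷'s LINE 2 «shift-cauchy-everyslope» (idea-7 ∕ CRIT-2; v3–v5 stubs `N17AtRecord13`, `D4AnchorRecord13`, `ContRecord13`,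
`D1AtRecord13Pos`) for two located reasons — its anchor ∕ (D1) texts reference the `v₀`-RAY numbers `Node00.beta0OfMerged … θ.v₀` of the record's DEFINITIONAL one-loop split
(CRIT-2 P2★; Negative p592695 `Anchor13FalseOfTwoBaseHistories`), and its (C) stub is BOX-WIDE (BN-F (N3), CRIT-1 g4 addendum) — «re-registration (v7) when a v₀-free corner road
… or a RUN-WISE SHIFT-RATE ROAD is LANDED+BUILT under `Theorems/`».  This file is that road, and it needs NO re-registration: the lever is re-proved SPLIT-FREE over DEF-1's
letters and lands ON THE REGISTERED 2ᴮ″ — at every admissible proviso'd Stage-13 tuple,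
  N17 (`N17At (datumOfRecord₁₃SepCoPH F 2 θ hP) u`, `u.γ = θ.γ`, `0 ≤ u.ρ < 1`: K3⁷ v3's N17 conjunct with the K2-junction letters displayed = v6's annex text `N17AtRecord13`)
  + `ScaleAnchor D.βfun (k ↦ θ.cβ · beta0OfJs F κ k)` (2ᴮ″'s OWN identification conjunct; NOT HIT by BN-F)
  + `SurvCont D.βfun γ₀` at every level `0 < γ₀ ≤ θ.γ` (2ᴮ″'s OWN (C) conjunct, run-wise)   ⟹   `RunRemAt F κ θ hP θ.cβ`   (★★ `runRemAt_of_n17At_scaleAnchor_survCont`),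
the cap `s ≤ θ.cβ · stepBal 2 F.L` met with EQUALITY because the lever delivers EVERY constant `s > 0` on a small enough box and `0 < θ.cβ · stepBal 2 F.L` (`Admissible.chart`,
`stepBal_L_pos`).  So 2ᴮ″'s quantitative (D4)∧B4 content «constant remainder below the scaled asymptotic-freedom slope along the in-window runs» is DISCHARGED by node N17's
qualitative-in-`s` scale-shift control plus the two qualitative conjuncts 2ᴮ″ already carries: beyond K3⁷'s N17, 2ᴮ″ owes only the anchor (identification of the record's
zero-history limits with the named numbers, per scale) and survivor continuity.  CRIT-2's P1 («the line MERGES K2's private XL (D4)-debt into K3's XL NE4-debt») thus holds AT THE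
REGISTERED v6 TEXT, v₀-free and BN-F-clean on the K2 side (N17 itself is K3⁷'s letter as K3 keys it — box-wide NE4 at the record; not re-keyed here).
WHY SPLIT-FREE (located): dag-n17-w2's lever (p593150 ∕ p593636) is stated for a `B12Beta.OneLoopSplit S`, whose field `vanish` forces `S.β0 k = β k p` at every history with
`p_k = 0` — the VALUE at the closed corner, not the limit from the open box; at the record the only split in the tree is the definitional one with `β0 := beta0OfMerged … θ.v₀`.
DEF-1's `ScaleAnchor β b` is the open-box LIMIT statement at ARBITRARY reference numbers `b`; the lever below is re-proved for the pair `(β, b)` directly.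

WHAT THIS FILE PROVES (kernel; every theorem CONDITIONAL on displayed hypothesis SHAPES).  §1 GENERIC, SPLIT-FREE (`β : HBeta`, `b : ℕ → ℝ`, a scale-shift MODULUS `a` of the
full β on the `]0,γ]`-boxes, `ScaleAnchor β b`): `abs_sub_succ_le_of_shiftModulus_scaleAnchor` (`|b_{k+1} − b_k| ≤ a_k`); `abs_remShift_le_two_mul_of_shiftModulus_scaleAnchor`;
`scaleAnchor_upTo`; `rem_iterate_of_remShift`; `exists_lim_of_summable_shiftModulus_scaleAnchor` (the reference numbers CONVERGE); ★ `exists_constRemainder_of_summable_shiftModulus_scaleAnchor`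
(Σ a_k < ∞ ⟹ ∀ s > 0 ∃ γ_s ∈ ]0,γ], `ConstRemainder β b s γ_s`); geometric instances from `ScaleShiftRate c ρ γ β`: `abs_sub_succ_le_of_scaleShiftRate_scaleAnchor`,
`conv_of_scaleShiftRate_scaleAnchor` (rate `(c∕(1−ρ))·ρ^k`), ★ `exists_constRemainder_of_scaleShiftRate_scaleAnchor`.  §2 LETTER SHAPES AND THE END, GENERIC:
`exists_runLetters_of_everyConst_survCont`; `survCont_allLevels_of_betaContH` (box (C) ⟹ the all-level survivor letter — the new letter is
WEAKER than LINE 2's S3); ★ `endpointExistence_of_summable_shiftModulus_scaleAnchor_drift_survCont`.  §3 AT NODE 00's STAGE-13 RECORD (`N = 2`):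
`cβ_mul_stepBal_pos`; `scaleShiftRate_of_n17At_window`; ★★ `runRemAt_of_n17At_scaleAnchor_survCont` (the box twin ⟹ ed.3's `RemAt` goes the same way through `ConstRemainder` + `BetaContH.mono`, not spelled); `runRemAt_of_summableShift_scaleAnchor_survCont`
(the summable-modulus hedge); `conv_beta0OfJs_of_n17At_scaleAnchor` ((AF-0r)'s CONCLUSION for the NAMED numbers at scale `θ.cβ`, v₀-free twin of dag-n17-w2's `af0r13_of_n17_anchor`).
§4 THE K2⁷ v6 TEXTS SPELLED INLINE (`Window13` spelled as the crux decl spells it): ★★ `runRemAtSomeJets_of_n17AtRecord13_anchorSurv` (the REGISTERED 2ᴮ″ TEXT from `N17AtRecord13`'s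
text + «∃ κ, anchor ∧ all-level survivor continuity»); ★★★ `EndpointGivenBR13SepCoPH_of_d1Anchored_n17_anchorSurv` (the crux decl BY NAME from {1ᴬ's text, `N17AtRecord13`'s text,
the anchor∕survivor text}, pointwise through DEF-1's `endpointExistence_of_runRemAt_drift`).

HONEST SCOPE (A6, director-ym №189).  Elementary real analysis over hypothesis SHAPES; §3–§4 quantify over `θ : Stage13HParams F 2` with `hP : θ.Provisos₁₃SepCoPH F 2` — inhabited
iff K0⁷ (stmt-QuantumFields-20541).  NOTHING of Bałaban is asserted or instantiated: NE4 NOT IN PRINT ([Balaban1987RG1] p. 264 «We will investigate other properties in a separate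
paper»; GAPS G-t4-U2-1) and NOT proved; the anchor's identification clause ((2.13) p. 268 read per scale AT THE NAMED numbers) NOT proved; (C) asserted in print without proof ([I] §1
pp. 263–264); row (D1) NOT proved; NOT a proof of `stub_runRemNamedJets13`, `stub_d1AnchoredJets13`, `stub_rates13H` or any stub; N17 NOT discharged (DEPENDENT∕DERIVED row); K2⁷ ∕
K3⁷ OPEN; counts UNMOVED (typed 28∕28 · discharged 5∕27 · A 5∕28).  One finite four-torus programme at fixed `ε = L^{−K}`, Bałaban AS PRINTED; the YM mass gap (Clay) is NOT proved
by any of this — R4 closes the conditional finite-𝕋⁴ rung `BalabanLadder.UV` only; nothing continuum ∕ ℝ⁴ ∕ OS.  No `instance`, no `notation`, no `axiom`.  ATTRIBUTION: the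
lever's mathematics is idea-7's (`Cruxes/EndpointGivenBR13SepCoPH/ShiftCauchyEverySlopeSketch.lean`) as sharpened by dag-n17-w2 (constant `2`, summable modulus); the run edition and
its END road are DEF-1's ∕ idea-4's over pub-balaban-gaps' `EndSurvivorCensus`; this seat's part is the split-free re-keying on `ScaleAnchor` and the junction onto the registered 2ᴮ″.
[I] = [Balaban1987RG1] T. Bałaban, CMP **109** (1987): Thm 2 p. 259, (1.3) p. 260, (1.20)–(1.22) p. 264, Thm 3 p. 264, (2.12)–(2.14) p. 268, (5.10) p. 293; [King1986] Thm 3.4 (3.9) p. 656.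
-/

noncomputable section

namespace Summit.QuantumFields.YangMills.BalabanUVNodes.N17RunRemAtOfShiftAnchor

open Literature.MathematicalPhysics.QuantumFieldTheory.Balaban1983to89
open Literature.MathematicalPhysics.QuantumFieldTheory.Balaban1983to89.FlowStep
open Literature.MathematicalPhysics.QuantumFieldTheory.Balaban1983to89.T4CouplingMatching (ScaleShiftRate)
open Literature.MathematicalPhysics.QuantumFieldTheory.Balaban1983to89.T4FlagMemory (tail_mem_box)
open Literature.MathematicalPhysics.QuantumFieldTheory.Balaban1983to89.B12Beta (HistBox)
open Literature.MathematicalPhysics.QuantumFieldTheory.Balaban1983to89.DagBinding (EndpointExistence ForwardGenerated)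
open Literature.MathematicalPhysics.QuantumFieldTheory.Balaban1983to89.T4Continuum (T4Family)
open Literature.MathematicalPhysics.QuantumFieldTheory.Balaban1983to89.Beta.Drift (OneLoopDrift)
open Summit.QuantumFields.YangMills.Theorems.BalabanUVNodesK2JsOfRecord (StepColourData beta0OfJs stepBal_L_pos)
open Summit.QuantumFields.YangMills.Theorems.BalabanUVNodesK2NamedJetsRemAt (ConstRemainder ScaleAnchor)
open Summit.QuantumFields.YangMills.Theorems.BalabanUVNodesK2NamedJetsRunRemAt (RunRemAt RunConstRemainder SurvCont runConstRemainder_of_constRemainder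
  endpointExistence_of_runRemAt_drift endpointExistence_of_drift_runConstRemainder_survCont)
open Finset Filter Topology

/-! ## §1 Generic, SPLIT-FREE: a scale-shift modulus of the full β + DEF-1's per-scale anchor at reference numbers `b` -/

section Generic

variable {β : HBeta} {b : ℕ → ℝ} {a : ℕ → ℝ} {γ : ℝ}

/-- **THE STEP OF THE REFERENCE NUMBERS under a scale-shift modulus of the full β and the anchor**: `|b_{k+1} − b_k| ≤ a_k`.  Evaluate the full-β shift at the constant
history `(t,…,t)` with `t` below `γ` and below the anchor radii of scales `k`, `k+1` at tolerance `ε∕2`, subtract, let `ε → 0`.  (Split-free twin of dag-n17-w2's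
`abs_beta0_step_le_of_shiftModulus_anchor`; idea-7's argument.) [cite: Balaban1987RG1, (2.12)-(2.14) p.268] -/
theorem abs_sub_succ_le_of_shiftModulus_scaleAnchor (hγ : 0 < γ) (hA : ScaleAnchor β b)
    (h : ∀ k (w : Fin (k + 2) → ℝ), w ∈ Box γ (k + 1) → |β (k + 1) w - β k (Fin.tail w)| ≤ a k) (k : ℕ) :
    |b (k + 1) - b k| ≤ a k := by
  refine le_of_forall_pos_le_add fun ε hε => ?_
  obtain ⟨γ₁, hγ₁, hA₁⟩ := hA (k + 1) (ε / 2) (half_pos hε)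
  obtain ⟨γ₀, hγ₀, hA₀⟩ := hA k (ε / 2) (half_pos hε)
  set t : ℝ := min γ (min γ₁ γ₀) with ht
  have ht0 : 0 < t := lt_min hγ (lt_min hγ₁ hγ₀)
  have htγ : t ≤ γ := min_le_left _ _
  have htγ₁ : t ≤ γ₁ := (min_le_right _ _).trans (min_le_left _ _)
  have htγ₀ : t ≤ γ₀ := (min_le_right _ _).trans (min_le_right _ _)
  let w : Fin (k + 2) → ℝ := fun _ => t
  have hw : w ∈ Box γ (k + 1) := mem_box.mpr fun _ => ⟨ht0, htγ⟩
  have hw₁ : w ∈ HistBox γ₁ (k + 1) := fun _ => ⟨ht0, htγ₁⟩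
  have hw₀ : Fin.tail w ∈ HistBox γ₀ k := fun _ => ⟨ht0, htγ₀⟩
  have h1 : |β (k + 1) w - β k (Fin.tail w)| ≤ a k := h k w hw
  have h2 : |β (k + 1) w - b (k + 1)| ≤ ε / 2 := hA₁ w hw₁
  have h3 : |β k (Fin.tail w) - b k| ≤ ε / 2 := hA₀ (Fin.tail w) hw₀
  have e : b (k + 1) - b k = (β (k + 1) w - β k (Fin.tail w)) - ((β (k + 1) w - b (k + 1)) - (β k (Fin.tail w) - b k)) := by ring
  rw [e]
  calc |(β (k + 1) w - β k (Fin.tail w)) - ((β (k + 1) w - b (k + 1)) - (β k (Fin.tail w) - b k))|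
      ≤ |β (k + 1) w - β k (Fin.tail w)| + |(β (k + 1) w - b (k + 1)) - (β k (Fin.tail w) - b k)| := abs_sub _ _
    _ ≤ a k + (|β (k + 1) w - b (k + 1)| + |β k (Fin.tail w) - b k|) := add_le_add h1 (abs_sub _ _)
    _ ≤ a k + (ε / 2 + ε / 2) := add_le_add le_rfl (add_le_add h2 h3)
    _ = a k + ε := by ring

/-- **THE «REMAINDER» `β_k(p) − b_k` HAS THE SHIFT MODULUS `2·a_k`** on the same boxes — subtract the step of the reference numbers from the full shift; NO hypothesis on the
modulus.  (Split-free twin of dag-n17-w2's `remainder_shift_le_two_mul_of_shiftModulus_anchor`, constant `2`.) [cite: Balaban1987RG1, (2.12)-(2.14) p.268] -/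
theorem abs_remShift_le_two_mul_of_shiftModulus_scaleAnchor (hγ : 0 < γ) (hA : ScaleAnchor β b)
    (h : ∀ k (w : Fin (k + 2) → ℝ), w ∈ Box γ (k + 1) → |β (k + 1) w - β k (Fin.tail w)| ≤ a k)
    (k : ℕ) (w : Fin (k + 2) → ℝ) (hw : w ∈ Box γ (k + 1)) :
    |(β (k + 1) w - b (k + 1)) - (β k (Fin.tail w) - b k)| ≤ 2 * a k := by
  have h0 : |b (k + 1) - b k| ≤ a k := abs_sub_succ_le_of_shiftModulus_scaleAnchor hγ hA h k
  have h1 : |β (k + 1) w - β k (Fin.tail w)| ≤ a k := h k w hw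
  have e : (β (k + 1) w - b (k + 1)) - (β k (Fin.tail w) - b k) = (β (k + 1) w - β k (Fin.tail w)) - (b (k + 1) - b k) := by ring
  rw [e]
  calc |(β (k + 1) w - β k (Fin.tail w)) - (b (k + 1) - b k)|
      ≤ |β (k + 1) w - β k (Fin.tail w)| + |b (k + 1) - b k| := abs_sub _ _
    _ ≤ a k + a k := add_le_add h1 h0
    _ = 2 * a k := by ring

/-- Finitely many scales of DEF-1's anchor at once (the minimum of finitely many positive radii).  (Split-free twin of `anchor_upTo`.) [folklore] -/
theorem scaleAnchor_upTo (hA : ScaleAnchor β b) (k₀ : ℕ) {δ : ℝ} (hδ : 0 < δ) :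
    ∃ γ' : ℝ, 0 < γ' ∧ ∀ k, k ≤ k₀ → ∀ p : Fin (k + 1) → ℝ, p ∈ HistBox γ' k → |β k p - b k| ≤ δ := by
  induction k₀ with
  | zero =>
    obtain ⟨γ', hγ', h'⟩ := hA 0 δ hδ
    refine ⟨γ', hγ', fun k hk p hp => ?_⟩
    obtain rfl := Nat.le_zero.mp hk
    exact h' p hp
  | succ n ih =>
    obtain ⟨γ₁, hγ₁, h₁⟩ := ih
    obtain ⟨γ₂, hγ₂, h₂⟩ := hA (n + 1) δ hδ
    refine ⟨min γ₁ γ₂, lt_min hγ₁ hγ₂, fun k hk p hp => ?_⟩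
    rcases Nat.lt_or_ge k (n + 1) with hlt | hge
    · exact h₁ k (Nat.lt_succ_iff.mp hlt) p fun i => ⟨(hp i).1, (hp i).2.trans (min_le_left _ _)⟩
    · obtain rfl := le_antisymm hk hge
      exact h₂ p fun i => ⟨(hp i).1, (hp i).2.trans (min_le_right _ _)⟩

/-- TELESCOPING along the ladder: from `|β_{k₀}(p) − b_{k₀}| ≤ B` on `]0,γ']^{k₀+1}` (`γ' ≤ γ`) and a shift modulus `r` of `β_k(p) − b_k` on the `]0,γ]`-boxes,
`|β_{k₀+m}(p) − b_{k₀+m}| ≤ B + Σ_{j<m} r_{k₀+j}` on `]0,γ']^{k₀+m+1}` (peel the ultraviolet-most coupling with `Fin.tail`).  (Split-free twin of `remainder_shift_iterate`.) [folklore] -/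
theorem rem_iterate_of_remShift {r : ℕ → ℝ} {γ' : ℝ}
    (hr : ∀ k (w : Fin (k + 2) → ℝ), w ∈ Box γ (k + 1) → |(β (k + 1) w - b (k + 1)) - (β k (Fin.tail w) - b k)| ≤ r k)
    (hγ' : γ' ≤ γ) (k₀ : ℕ) {B : ℝ} (hbase : ∀ p : Fin (k₀ + 1) → ℝ, p ∈ Box γ' k₀ → |β k₀ p - b k₀| ≤ B) :
    ∀ m : ℕ, ∀ p : Fin (k₀ + m + 1) → ℝ, p ∈ Box γ' (k₀ + m) → |β (k₀ + m) p - b (k₀ + m)| ≤ B + ∑ j ∈ range m, r (k₀ + j) := by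
  intro m
  induction m with
  | zero => intro p hp; simpa using hbase p hp
  | succ m ih =>
    intro p hp
    have hp₁ : p ∈ Box γ (k₀ + m + 1) := box_mono hγ' _ hp
    have hs : |(β (k₀ + m + 1) p - b (k₀ + m + 1)) - (β (k₀ + m) (Fin.tail p) - b (k₀ + m))| ≤ r (k₀ + m) := hr (k₀ + m) p hp₁
    have ht : |β (k₀ + m) (Fin.tail p) - b (k₀ + m)| ≤ B + ∑ j ∈ range m, r (k₀ + j) := ih (Fin.tail p) (tail_mem_box hp)
    have htri : |β (k₀ + m + 1) p - b (k₀ + m + 1)| - |β (k₀ + m) (Fin.tail p) - b (k₀ + m)|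
        ≤ |(β (k₀ + m + 1) p - b (k₀ + m + 1)) - (β (k₀ + m) (Fin.tail p) - b (k₀ + m))| :=
      abs_sub_abs_le_abs_sub _ _
    rw [Finset.sum_range_succ]
    show |β (k₀ + m + 1) p - b (k₀ + m + 1)| ≤ B + (∑ j ∈ range m, r (k₀ + j) + r (k₀ + m))
    linarith

/-- **THE REFERENCE NUMBERS CONVERGE under a SUMMABLE modulus + the anchor**, with the tail bound `|b_k − b_∞| ≤ Σ_m a_{k+m}` — (AF-0r)'s CONCLUSION for WHATEVER numbers
anchor the β-family, split-free (Mathlib's `cauchySeq_of_dist_le_of_summable` ∕ `dist_le_tsum_of_dist_le_of_tendsto`). [folklore] -/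
theorem exists_lim_of_summable_shiftModulus_scaleAnchor (hγ : 0 < γ) (hA : ScaleAnchor β b)
    (h : ∀ k (w : Fin (k + 2) → ℝ), w ∈ Box γ (k + 1) → |β (k + 1) w - β k (Fin.tail w)| ≤ a k) (ha : Summable a) :
    ∃ binf : ℝ, Tendsto b atTop (𝓝 binf) ∧ ∀ k, |b k - binf| ≤ ∑' m, a (k + m) := by
  have hstep : ∀ n, dist (b n) (b n.succ) ≤ a n := fun n => by
    rw [Real.dist_eq, abs_sub_comm]
    exact abs_sub_succ_le_of_shiftModulus_scaleAnchor hγ hA h n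
  obtain ⟨binf, hlim⟩ := cauchySeq_tendsto_of_complete (cauchySeq_of_dist_le_of_summable a hstep ha)
  refine ⟨binf, hlim, fun k => ?_⟩
  have hk := dist_le_tsum_of_dist_le_of_tendsto a hstep ha hlim k
  rwa [Real.dist_eq] at hk

/-- ★ **THE LEVER, SPLIT-FREE: a SUMMABLE scale-shift modulus of the full β + DEF-1's anchor ⟹ EVERY CONSTANT REMAINDER on a small enough box** — `∀ s > 0 ∃ γ_s ∈ ]0, γ]`,
`ConstRemainder β b s γ_s` (`|β_k(p) − b_k| ≤ s` on `]0,γ_s]^{k+1}`, ALL `k`).  Given `s`: the remainder's modulus is `2a`; pick `k₀` with the tail `Σ_j 2a_{j+k₀} < s∕2`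
(`tendsto_sum_nat_add`), one anchor radius for the scales `k ≤ k₀` at tolerance `s∕2` (`scaleAnchor_upTo`), telescope for `k > k₀` (`rem_iterate_of_remShift`).  (Split-free
twin of dag-n17-w2's `everySlope_of_summable_shiftModulus_anchor`; idea-7's `everySlope_of_shiftRate_anchor`.) [cite: Balaban1987RG1, (2.12)-(2.14) p.268 and Thm 3 p.264] -/
theorem exists_constRemainder_of_summable_shiftModulus_scaleAnchor (hγ : 0 < γ) (hA : ScaleAnchor β b)
    (h : ∀ k (w : Fin (k + 2) → ℝ), w ∈ Box γ (k + 1) → |β (k + 1) w - β k (Fin.tail w)| ≤ a k) (ha : Summable a)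
    {s : ℝ} (hs : 0 < s) : ∃ γs : ℝ, 0 < γs ∧ γs ≤ γ ∧ ConstRemainder β b s γs := by
  have ha0 : ∀ k, 0 ≤ a k := fun k => (abs_nonneg _).trans (h k (fun _ => γ) (mem_box.mpr fun _ => ⟨hγ, le_rfl⟩))
  have hr : ∀ k (w : Fin (k + 2) → ℝ), w ∈ Box γ (k + 1) → |(β (k + 1) w - b (k + 1)) - (β k (Fin.tail w) - b k)| ≤ 2 * a k :=
    abs_remShift_le_two_mul_of_shiftModulus_scaleAnchor hγ hA h
  have h2a : Summable fun k => 2 * a k := ha.mul_left 2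
  have htail : Tendsto (fun i => ∑' j, 2 * a (j + i)) atTop (𝓝 0) := tendsto_sum_nat_add fun k => 2 * a k
  obtain ⟨k₀, hk₀⟩ := (htail.eventually (gt_mem_nhds (half_pos hs))).exists
  obtain ⟨γa, hγa, hanchor⟩ := scaleAnchor_upTo hA k₀ (half_pos hs)
  refine ⟨min γ γa, lt_min hγ hγa, min_le_left _ _, ?_⟩
  intro k p hp
  have hp' : p ∈ Box (min γ γa) k := by rw [← histBox_eq_box]; exact hp
  rcases Nat.lt_or_ge k₀ k with hk | hk
  · obtain ⟨m, rfl⟩ := Nat.exists_eq_add_of_le hk.le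
    have hiter := rem_iterate_of_remShift hr (min_le_left γ γa) k₀ (B := s / 2)
      (fun q hq => hanchor k₀ le_rfl q fun i => ⟨(mem_box.mp hq i).1, (mem_box.mp hq i).2.trans (min_le_right _ _)⟩) m p hp'
    have hsum2 : Summable fun j => 2 * a (j + k₀) := (summable_nat_add_iff k₀).2 h2a
    have hpart : ∑ j ∈ range m, 2 * a (k₀ + j) ≤ ∑' j, 2 * a (j + k₀) := by
      have e : ∑ j ∈ range m, 2 * a (k₀ + j) = ∑ j ∈ range m, 2 * a (j + k₀) :=
        Finset.sum_congr rfl fun j _ => by rw [Nat.add_comm]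
      rw [e]
      exact hsum2.sum_le_tsum (range m) fun j _ => mul_nonneg zero_le_two (ha0 _)
    linarith [hk₀.le]
  · exact (hanchor k hk p fun i => ⟨(hp i).1, (hp i).2.trans (min_le_right _ _)⟩).trans (half_le_self hs.le)

/-! ### The geometric instances BY NAME: NE4 `ScaleShiftRate c ρ γ β` (node N17's shape) -/
variable {c ρ : ℝ}

/-- NE4 + DEF-1's anchor ⟹ the step of the reference numbers `|b_{k+1} − b_k| ≤ c·ρ^k` (NO hypothesis on `ρ`). [cite: Balaban1987RG1, (2.12)-(2.14) p.268] -/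
theorem abs_sub_succ_le_of_scaleShiftRate_scaleAnchor (hγ : 0 < γ) (hA : ScaleAnchor β b) (h : ScaleShiftRate c ρ γ β) (k : ℕ) :
    |b (k + 1) - b k| ≤ c * ρ ^ k :=
  abs_sub_succ_le_of_shiftModulus_scaleAnchor hγ hA h k

/-- NE4 (`ρ < 1`) + DEF-1's anchor ⟹ the reference numbers converge GEOMETRICALLY: `|b_k − b_∞| ≤ (c∕(1−ρ))·ρ^k` — (AF-0r)'s conclusion for the anchoring numbers, split-free
(geometric Cauchy: `cauchySeq_of_le_geometric`, `dist_le_of_le_geometric_of_tendsto`). [folklore] -/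
theorem conv_of_scaleShiftRate_scaleAnchor (hγ : 0 < γ) (hρ1 : ρ < 1) (hA : ScaleAnchor β b) (h : ScaleShiftRate c ρ γ β) :
    ∃ binf : ℝ, Tendsto b atTop (𝓝 binf) ∧ ∀ k, |b k - binf| ≤ c / (1 - ρ) * ρ ^ k := by
  have hstep : ∀ n, dist (b n) (b (n + 1)) ≤ c * ρ ^ n := fun n => by
    rw [Real.dist_eq, abs_sub_comm]
    exact abs_sub_succ_le_of_scaleShiftRate_scaleAnchor hγ hA h n
  obtain ⟨binf, hlim⟩ := cauchySeq_tendsto_of_complete (cauchySeq_of_le_geometric ρ c hρ1 hstep)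
  refine ⟨binf, hlim, fun k => ?_⟩
  have hk := dist_le_of_le_geometric_of_tendsto ρ c hρ1 hstep hlim k
  rw [Real.dist_eq] at hk
  calc |b k - binf| ≤ c * ρ ^ k / (1 - ρ) := hk
    _ = c / (1 - ρ) * ρ ^ k := by ring

/-- ★ NE4 (`0 ≤ ρ < 1`) + DEF-1's anchor ⟹ EVERY CONSTANT REMAINDER on a small enough box: `∀ s > 0 ∃ γ_s ∈ ]0,γ]`, `ConstRemainder β b s γ_s` (the geometric modulus is
summable). [cite: Balaban1987RG1, (2.12)-(2.14) p.268 and Thm 3 p.264] -/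
theorem exists_constRemainder_of_scaleShiftRate_scaleAnchor (hγ : 0 < γ) (hρ0 : 0 ≤ ρ) (hρ1 : ρ < 1) (hA : ScaleAnchor β b)
    (h : ScaleShiftRate c ρ γ β) {s : ℝ} (hs : 0 < s) : ∃ γs : ℝ, 0 < γs ∧ γs ≤ γ ∧ ConstRemainder β b s γs :=
  exists_constRemainder_of_summable_shiftModulus_scaleAnchor hγ hA h ((summable_geometric_of_lt_one hρ0 hρ1).mul_left c) hs

end Generic

/-! ## §2 The run LETTER SHAPE assembled from «every constant», a positive cap and run-wise (C); the END (DEF-1's run-wise road BY NAME) -/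

section Letters

variable {β : HBeta} {b : ℕ → ℝ} {γ : ℝ}

/-- **THE RUN LETTER's SHAPE from «every constant» + a POSITIVE cap + run-wise (C) at all levels**: `∃ γ₀ s, 0 < γ₀ ≤ γ ∧ s ≤ S ∧ RunConstRemainder β b s γ₀ ∧ ScaleAnchor β b ∧
SurvCont β γ₀` — DEF-1's `RunRemAt` body over abstract `(β, b, γ, S)`; the cap is met with EQUALITY `s := S` (box ⟹ runs by DEF-1's `runConstRemainder_of_constRemainder`). [folklore] -/
theorem exists_runLetters_of_everyConst_survCont {S : ℝ} (hS : 0 < S) (hA : ScaleAnchor β b)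
    (hev : ∀ s : ℝ, 0 < s → ∃ γs : ℝ, 0 < γs ∧ γs ≤ γ ∧ ConstRemainder β b s γs)
    (hsc : ∀ γ₀ : ℝ, 0 < γ₀ → γ₀ ≤ γ → SurvCont β γ₀) :
    ∃ γ₀ s : ℝ, 0 < γ₀ ∧ γ₀ ≤ γ ∧ s ≤ S ∧ RunConstRemainder β b s γ₀ ∧ ScaleAnchor β b ∧ SurvCont β γ₀ := by
  obtain ⟨γs, hγs, hγsγ, hrem⟩ := hev S hS
  exact ⟨γs, S, hγs, hγsγ, le_rfl, runConstRemainder_of_constRemainder hrem, hA, hsc γs hγs hγsγ⟩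

/-- Box (C) on `]0, γ]` gives run-wise (C) at EVERY level `γ₀ ≤ γ` (DEF-1's `SurvCont.of_betaContH` on the sub-box) — so the all-level survivor-continuity letter is WEAKER than
LINE 2's box (C) by name. [folklore] -/
theorem survCont_allLevels_of_betaContH (hC : BetaContH γ β) : ∀ γ₀ : ℝ, 0 < γ₀ → γ₀ ≤ γ → SurvCont β γ₀ :=
  fun _γ₀ hγ₀ hle => Summit.QuantumFields.YangMills.Theorems.BalabanUVNodesK2NamedJetsRunRemAt.SurvCont.of_betaContH hγ₀ fun k => (hC k).mono (box_mono hle k)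

/-- ★ **END, GENERIC, SPLIT-FREE AND RUN-WISE ON THE (C) SIDE**: a forward-generated construction, a SUMMABLE scale-shift modulus of its β-family on the `]0,γ]`-boxes, DEF-1's
anchor at numbers `b` drifting with a POSITIVE slope `s₀`, and run-wise (C) at every level `≤ γ` ⟹ `EndpointExistence C` — the lever at `s := s₀` feeds DEF-1's
`endpointExistence_of_drift_runConstRemainder_survCont` (pub-balaban-gaps' `EndSurvivorCensus` inside).  CONDITIONAL; nothing of Bałaban asserted.
[cite: Balaban1987RG1, Thm 2 p.259 (first sentence), (2.12)-(2.14) p.268 and (5.10) p.293] -/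
theorem endpointExistence_of_summable_shiftModulus_scaleAnchor_drift_survCont {C : B12.Construction} (hgen : ForwardGenerated C β) (hγ : 0 < γ)
    {a : ℕ → ℝ} (h : ∀ k (w : Fin (k + 2) → ℝ), w ∈ Box γ (k + 1) → |β (k + 1) w - β k (Fin.tail w)| ≤ a k) (ha : Summable a)
    (hA : ScaleAnchor β b) {s₀ A : ℝ} (hs₀ : 0 < s₀) (hdrift : OneLoopDrift s₀ A b) (hsc : ∀ γ₀ : ℝ, 0 < γ₀ → γ₀ ≤ γ → SurvCont β γ₀) :
    EndpointExistence C := by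
  obtain ⟨γs, hγs, hγsγ, hrem⟩ := exists_constRemainder_of_summable_shiftModulus_scaleAnchor hγ hA h ha hs₀
  exact endpointExistence_of_drift_runConstRemainder_survCont hgen hγs hdrift (runConstRemainder_of_constRemainder hrem) le_rfl (hsc γs hγs hγsγ)

end Letters

/-! ## §3 At NODE 00's Stage-13 record (`N = 2`): node N17 + the anchor at the NAMED numbers `θ.cβ · beta0OfJs F κ` ⟹ DEF-1's letters -/

section Record

open YMDAG.UVSplit (U3Carriers N17At)

variable (F : T4Family) (κ : StepColourData) (θ : Node00.Stage13HParams F 2) (hP : θ.Provisos₁₃SepCoPH F 2)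

/-- The scaled asymptotic-freedom slope of an ADMISSIBLE tuple is positive: `0 < θ.cβ · stepBal 2 F.L` (`Stage9Params.Admissible.chart` gives `0 < θ.cβ`; DEF-1's
`stepBal_L_pos`). [folklore] -/
theorem cβ_mul_stepBal_pos (hθ : θ.Admissible F 2) : 0 < θ.cβ * B12Normalization.stepBal 2 F.L :=
  mul_pos hθ.toStage9.chart.1 (stepBal_L_pos F two_pos)

/-- N17 on a Stage-13 datum of record at a bundle whose window letter IS `θ.γ` is NE4 `ScaleShiftRate (u.cr·u.C₅·u.θ) u.ρ θ.γ` of the datum's β (`YMDAG.UVSplit.N17At`, `rfl` + `u.γ = θ.γ`).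
[cite: Balaban1987RG1, (1.20)-(1.22) p.264] -/
theorem scaleShiftRate_of_n17At_window {u : U3Carriers} (hγu : u.γ = θ.γ) (h17 : N17At (Node00.datumOfRecord₁₃SepCoPH F 2 θ hP) u) :
    ScaleShiftRate (u.cr * u.C₅ * u.θ) u.ρ θ.γ (Node00.datumOfRecord₁₃SepCoPH F 2 θ hP).βfun := by
  have h'' : ScaleShiftRate (u.cr * u.C₅ * u.θ) u.ρ u.γ (Node00.datumOfRecord₁₃SepCoPH F 2 θ hP).βfun := h17
  rwa [hγu] at h''

/-- ★★ **NODE N17 ⟹ THE REGISTERED RUN LETTER.**  At an admissible proviso'd Stage-13 tuple: N17 on the datum of record at a carrier bundle with node U3's window `= θ.γ` and rate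
letter `0 ≤ u.ρ < 1` (K3⁷ v3's N17 conjunct with the K2-junction letters displayed; = the body of K2⁷ v6's annex text `N17AtRecord13`) + DEF-1's ANCHOR of the record's β at the
named numbers `θ.cβ · beta0OfJs F κ` + run-wise (C) at every level `≤ θ.γ` ⟹ `RunRemAt F κ θ hP θ.cβ` — 2ᴮ″'s letter, its cap `s ≤ θ.cβ · stepBal 2 F.L` met with equality.
`N17At D u` IS `ScaleShiftRate (u.cr·u.C₅·u.θ) u.ρ u.γ D.βfun` (`YMDAG.UVSplit.N17At`, `Spine.NE4.Targets.NE4OnData`, `rfl`).  CONDITIONAL; N17 ∕ the anchor ∕ (C) NOT proved.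
[cite: Balaban1987RG1, (1.20)-(1.22) p.264, (2.12)-(2.14) p.268 and Thm 3 p.264] -/
theorem runRemAt_of_n17At_scaleAnchor_survCont (hθ : θ.Admissible F 2) {u : U3Carriers} (hγu : u.γ = θ.γ) (hρ0 : 0 ≤ u.ρ) (hρ1 : u.ρ < 1)
    (h17 : N17At (Node00.datumOfRecord₁₃SepCoPH F 2 θ hP) u)
    (hA : ScaleAnchor (Node00.datumOfRecord₁₃SepCoPH F 2 θ hP).βfun (fun k => θ.cβ * beta0OfJs F κ k))
    (hsc : ∀ γ₀ : ℝ, 0 < γ₀ → γ₀ ≤ θ.γ → SurvCont (Node00.datumOfRecord₁₃SepCoPH F 2 θ hP).βfun γ₀) :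
    RunRemAt F κ θ hP θ.cβ := by
  have hγ : 0 < θ.γ := hθ.toStage12.toStage9.gamma_pos
  have h' := scaleShiftRate_of_n17At_window F θ hP hγu h17
  exact exists_runLetters_of_everyConst_survCont (cβ_mul_stepBal_pos F θ hθ) hA
    (fun s hs => exists_constRemainder_of_scaleShiftRate_scaleAnchor hγ hρ0 hρ1 hA h' hs) hsc

/-- **THE SUMMABLE-MODULUS HEDGE** (dag-n17-w2's located minimum, split-free): SOME summable two-run scale-shift modulus of the record's β on the `]0, θ.γ]`-boxes (strictly WEAKER
than N17's geometric rate, p595280 `summable_shiftModulus_anchor_not_geometric`) + the anchor + run-wise (C) at every level ⟹ `RunRemAt F κ θ hP θ.cβ`.  CONDITIONAL.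
[cite: Balaban1987RG1, (2.12)-(2.14) p.268 and Thm 3 p.264] -/
theorem runRemAt_of_summableShift_scaleAnchor_survCont (hθ : θ.Admissible F 2)
    (hmod : ∃ a : ℕ → ℝ, Summable a ∧ ∀ k (w : Fin (k + 2) → ℝ), w ∈ Box θ.γ (k + 1) →
      |(Node00.datumOfRecord₁₃SepCoPH F 2 θ hP).βfun (k + 1) w - (Node00.datumOfRecord₁₃SepCoPH F 2 θ hP).βfun k (Fin.tail w)| ≤ a k)
    (hA : ScaleAnchor (Node00.datumOfRecord₁₃SepCoPH F 2 θ hP).βfun (fun k => θ.cβ * beta0OfJs F κ k))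
    (hsc : ∀ γ₀ : ℝ, 0 < γ₀ → γ₀ ≤ θ.γ → SurvCont (Node00.datumOfRecord₁₃SepCoPH F 2 θ hP).βfun γ₀) :
    RunRemAt F κ θ hP θ.cβ := by
  have hγ : 0 < θ.γ := hθ.toStage12.toStage9.gamma_pos
  obtain ⟨a, ha, h⟩ := hmod
  exact exists_runLetters_of_everyConst_survCont (cβ_mul_stepBal_pos F θ hθ) hA
    (fun s hs => exists_constRemainder_of_summable_shiftModulus_scaleAnchor hγ hA h ha hs) hsc

/-- **(AF-0r)'s CONCLUSION FOR THE NAMED NUMBERS AT SCALE `θ.cβ`, v₀-FREE**: N17 on the datum of record (`0 ≤ u.ρ < 1`, window `θ.γ`) + the anchor at `θ.cβ · beta0OfJs F κ`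
⟹ the scaled named one-loop numbers converge geometrically, `|θ.cβ·b_k − b_∞| ≤ (c∕(1−u.ρ))·u.ρ^k` with `c := u.cr·u.C₅·u.θ` (contrast dag-n17-w2's `af0r13_of_n17_anchor`, which
concludes for the `v₀`-ray numbers `beta0OfMerged … θ.v₀` of the definitional split).  CONDITIONAL. [cite: Balaban1987RG1, (1.20)-(1.22) p.264 and (2.12)-(2.14) p.268] -/
theorem conv_beta0OfJs_of_n17At_scaleAnchor (hθ : θ.Admissible F 2) {u : U3Carriers} (hγu : u.γ = θ.γ) (hρ1 : u.ρ < 1)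
    (h17 : N17At (Node00.datumOfRecord₁₃SepCoPH F 2 θ hP) u)
    (hA : ScaleAnchor (Node00.datumOfRecord₁₃SepCoPH F 2 θ hP).βfun (fun k => θ.cβ * beta0OfJs F κ k)) :
    ∃ binf : ℝ, Tendsto (fun k => θ.cβ * beta0OfJs F κ k) atTop (𝓝 binf) ∧
      ∀ k, |θ.cβ * beta0OfJs F κ k - binf| ≤ u.cr * u.C₅ * u.θ / (1 - u.ρ) * u.ρ ^ k := by
  have hγ : 0 < θ.γ := hθ.toStage12.toStage9.gamma_pos
  have h' := scaleShiftRate_of_n17At_window F θ hP hγu h17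
  exact conv_of_scaleShiftRate_scaleAnchor hγ hρ1 hA h'

end Record

/-! ## §4 The K2⁷ v6 TEXTS spelled INLINE (the skeleton is not a tree module; `Window13 F θ hP` is spelled as the crux decl spells it) and the composition BY NAME

* 2ᴮ″ (REGISTERED, `stub_runRemNamedJets13 : RunRemAtSomeJets`): full prefix → `∃ κ, RunRemAt F κ θ hP θ.cβ`.
* 1ᴬ (REGISTERED, `stub_d1AnchoredJets13 : D1AtAnchoredJets`): full prefix → anchor → `∃ A, OneLoopDrift (stepBal 2 F.L) A (beta0OfJs F κ)`.
* `N17AtRecord13` (v6 annex, unregistered; K3⁷ v3's N17 conjunct displayed): full prefix → `∃ u, u.γ = θ.γ ∧ 0 ≤ u.ρ ∧ u.ρ < 1 ∧ N17At (datum) u`.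
* THE NEW TEXT «SOME κ anchors, with all-level survivor continuity» (this file's; BN-F-immune; its two conjuncts are 2ᴮ″'s own, and its (C) half is implied by LINE 2's box S3
  via `survCont_allLevels_of_betaContH`): full prefix → `∃ κ, ScaleAnchor (datum).βfun (θ.cβ • beta0OfJs F κ) ∧ ∀ γ₀ ∈ ]0, θ.γ], SurvCont (datum).βfun γ₀`. -/

section Texts

open YMDAG.UVSplit (U3Carriers N17At)

/-- ★★ **THE REGISTERED 2ᴮ″ TEXT FROM NODE N17 + «SOME κ ANCHORS, WITH ALL-LEVEL SURVIVOR CONTINUITY»** (both hypotheses spelled with K2⁷ v6's full prefix; conclusion = v6's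
`RunRemAtSomeJets` body VERBATIM).  CONDITIONAL on the two displayed texts; NOT a proof of `stub_runRemNamedJets13`. [cite: Balaban1987RG1, (1.20)-(1.22) p.264, (2.12)-(2.14) p.268 and Thm 3 p.264] -/
theorem runRemAtSomeJets_of_n17AtRecord13_anchorSurv
    (hN : ∀ (F : T4Family) (θ : Node00.Stage13HParams F 2) (hP : θ.Provisos₁₃SepCoPH F 2), (θ.ZhUnity F 2 ∧ θ.SlotsNondegenerate₁₃ F 2) → θ.Admissible F 2 →
      B16.EndStatementBPrinted (Node00.datumOfRecord₁₃SepCoPH F 2 θ hP).C →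
      (∃ γ₁ : ℝ, 0 < γ₁ ∧ ∀ γ : ℝ, 0 < γ → γ ≤ γ₁ → ∃ P : B12.RunParams, 1 ≤ P.K ∧ ((Node00.datumOfRecord₁₃SepCoPH F 2 θ hP).C P).flow.InInterval γ P.K) →
      ∃ u : U3Carriers, u.γ = θ.γ ∧ 0 ≤ u.ρ ∧ u.ρ < 1 ∧ N17At (Node00.datumOfRecord₁₃SepCoPH F 2 θ hP) u)
    (hAS : ∀ (F : T4Family) (θ : Node00.Stage13HParams F 2) (hP : θ.Provisos₁₃SepCoPH F 2), (θ.ZhUnity F 2 ∧ θ.SlotsNondegenerate₁₃ F 2) → θ.Admissible F 2 →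
      B16.EndStatementBPrinted (Node00.datumOfRecord₁₃SepCoPH F 2 θ hP).C →
      (∃ γ₁ : ℝ, 0 < γ₁ ∧ ∀ γ : ℝ, 0 < γ → γ ≤ γ₁ → ∃ P : B12.RunParams, 1 ≤ P.K ∧ ((Node00.datumOfRecord₁₃SepCoPH F 2 θ hP).C P).flow.InInterval γ P.K) →
      ∃ κ : StepColourData, ScaleAnchor (Node00.datumOfRecord₁₃SepCoPH F 2 θ hP).βfun (fun k => θ.cβ * beta0OfJs F κ k) ∧
        ∀ γ₀ : ℝ, 0 < γ₀ → γ₀ ≤ θ.γ → SurvCont (Node00.datumOfRecord₁₃SepCoPH F 2 θ hP).βfun γ₀) :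
    ∀ (F : T4Family) (θ : Node00.Stage13HParams F 2) (hP : θ.Provisos₁₃SepCoPH F 2), (θ.ZhUnity F 2 ∧ θ.SlotsNondegenerate₁₃ F 2) → θ.Admissible F 2 →
      B16.EndStatementBPrinted (Node00.datumOfRecord₁₃SepCoPH F 2 θ hP).C →
      (∃ γ₁ : ℝ, 0 < γ₁ ∧ ∀ γ : ℝ, 0 < γ → γ ≤ γ₁ → ∃ P : B12.RunParams, 1 ≤ P.K ∧ ((Node00.datumOfRecord₁₃SepCoPH F 2 θ hP).C P).flow.InInterval γ P.K) →
      ∃ κ : StepColourData, RunRemAt F κ θ hP θ.cβ := by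
  intro F θ hP hU hθ hB hwin
  obtain ⟨u, hγu, hρ0, hρ1, h17⟩ := hN F θ hP hU hθ hB hwin
  obtain ⟨κ, hA, hsc⟩ := hAS F θ hP hU hθ hB hwin
  exact ⟨κ, runRemAt_of_n17At_scaleAnchor_survCont F κ θ hP hθ hγu hρ0 hρ1 h17 hA hsc⟩

/-- ★★★ **THE CRUX DECL `EndpointGivenBR13SepCoPH` BY NAME FROM {1ᴬ's TEXT, `N17AtRecord13`'s TEXT, THE ANCHOR∕SURVIVOR TEXT}** — pointwise: κ and the anchor from the third text,
the run letter from node N17 (`runRemAt_of_n17At_scaleAnchor_survCont`), the bare drift from 1ᴬ at that anchor, DEF-1's `endpointExistence_of_runRemAt_drift`.  = K2⁷ v6's registered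
composition `EndpointGivenBR13SepCoPH_of_anchoredJetsRun` with its XL hypothesis 2ᴮ″ REPLACED by N17 + the anchor∕survivor text.  CONDITIONAL on the three displayed hypothesis
texts; K2⁷ NOT closed; nothing of Bałaban asserted. [cite: Balaban1987RG1, Thm 2 p.259 (first sentence), (1.3) p.260, (1.20)-(1.22) p.264 and (2.12)-(2.14) p.268] -/
theorem EndpointGivenBR13SepCoPH_of_d1Anchored_n17_anchorSurv
    (h₁ : ∀ (F : T4Family) (κ : StepColourData) (θ : Node00.Stage13HParams F 2) (hP : θ.Provisos₁₃SepCoPH F 2), (θ.ZhUnity F 2 ∧ θ.SlotsNondegenerate₁₃ F 2) →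
      θ.Admissible F 2 → B16.EndStatementBPrinted (Node00.datumOfRecord₁₃SepCoPH F 2 θ hP).C →
      (∃ γ₁ : ℝ, 0 < γ₁ ∧ ∀ γ : ℝ, 0 < γ → γ ≤ γ₁ → ∃ P : B12.RunParams, 1 ≤ P.K ∧ ((Node00.datumOfRecord₁₃SepCoPH F 2 θ hP).C P).flow.InInterval γ P.K) →
      ScaleAnchor (Node00.datumOfRecord₁₃SepCoPH F 2 θ hP).βfun (fun k => θ.cβ * beta0OfJs F κ k) →
      ∃ A : ℝ, OneLoopDrift (B12Normalization.stepBal 2 F.L) A (beta0OfJs F κ))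
    (hN : ∀ (F : T4Family) (θ : Node00.Stage13HParams F 2) (hP : θ.Provisos₁₃SepCoPH F 2), (θ.ZhUnity F 2 ∧ θ.SlotsNondegenerate₁₃ F 2) → θ.Admissible F 2 →
      B16.EndStatementBPrinted (Node00.datumOfRecord₁₃SepCoPH F 2 θ hP).C →
      (∃ γ₁ : ℝ, 0 < γ₁ ∧ ∀ γ : ℝ, 0 < γ → γ ≤ γ₁ → ∃ P : B12.RunParams, 1 ≤ P.K ∧ ((Node00.datumOfRecord₁₃SepCoPH F 2 θ hP).C P).flow.InInterval γ P.K) →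
      ∃ u : U3Carriers, u.γ = θ.γ ∧ 0 ≤ u.ρ ∧ u.ρ < 1 ∧ N17At (Node00.datumOfRecord₁₃SepCoPH F 2 θ hP) u)
    (hAS : ∀ (F : T4Family) (θ : Node00.Stage13HParams F 2) (hP : θ.Provisos₁₃SepCoPH F 2), (θ.ZhUnity F 2 ∧ θ.SlotsNondegenerate₁₃ F 2) → θ.Admissible F 2 →
      B16.EndStatementBPrinted (Node00.datumOfRecord₁₃SepCoPH F 2 θ hP).C →
      (∃ γ₁ : ℝ, 0 < γ₁ ∧ ∀ γ : ℝ, 0 < γ → γ ≤ γ₁ → ∃ P : B12.RunParams, 1 ≤ P.K ∧ ((Node00.datumOfRecord₁₃SepCoPH F 2 θ hP).C P).flow.InInterval γ P.K) →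
      ∃ κ : StepColourData, ScaleAnchor (Node00.datumOfRecord₁₃SepCoPH F 2 θ hP).βfun (fun k => θ.cβ * beta0OfJs F κ k) ∧
        ∀ γ₀ : ℝ, 0 < γ₀ → γ₀ ≤ θ.γ → SurvCont (Node00.datumOfRecord₁₃SepCoPH F 2 θ hP).βfun γ₀) :
    Summit.QuantumFields.YangMills.Theses.BalabanUVNodes.EndpointGivenBR13SepCoPH := by
  intro F θ hP hU hθ hB hwin
  obtain ⟨u, hγu, hρ0, hρ1, h17⟩ := hN F θ hP hU hθ hB hwin
  obtain ⟨κ, hA, hsc⟩ := hAS F θ hP hU hθ hB hwin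
  have hRun : RunRemAt F κ θ hP θ.cβ := runRemAt_of_n17At_scaleAnchor_survCont F κ θ hP hθ hγu hρ0 hρ1 h17 hA hsc
  obtain ⟨A, hdrift⟩ := h₁ F κ θ hP hU hθ hB hwin hA
  exact endpointExistence_of_runRemAt_drift F κ θ hP hRun hdrift

end Texts

end Summit.QuantumFields.YangMills.BalabanUVNodes.N17RunRemAtOfShiftAnchor

end
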